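import Literature.MathematicalPhysics.QuantumLattice.AnisotropicSectorSupport
import HarnessLib

/-!
# Isotropic sectors `F̄_{h,ω̄} = f_h ζ̄_{h,ω̄}` (Benfatto–Giuliani–Mastropietro 2006, (2.57)–(2.58))

Topic `Literature/MathematicalPhysics/QuantumLattice`; companion of `AnisotropicSectors.lean` /
`AnisotropicSectorSupport.lean`. BGM 2006, end of §2.5 (p. 11): "it will also be convenient to
introduce, besides the anisotropic sector functions, the isotropic ones": angles
`θ̄_{h,ω̄} = (ω̄ + ½)πγ^h`, `ω̄ ∈ Ō_h = {0, …, γ^{-h}·2 - 1}` hmm (`γ^{-(h-1)}`… with `γ = 4`: `2·4ⁿ`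
sectors of width `π4^{-n}`), smooth `ζ̄_{h,ω̄}` equal to `1` for `‖θ - θ̄‖ < ¼πγ^h`, to `0` for
`‖θ - θ̄‖ > ¾πγ^h`, summing to `1` (2.57), and `F̄_{h,ω̄}(k) = f_h(k) ζ̄_{h,ω̄}(θ)`; on its support
`k⃗ = p_F(θ̄_{h,ω̄}) + k'` with `k' = O(γ^h)` (2.58).

With `γ = 4` the isotropic angular partition at scale `h = -n` is EXACTLY the circle partition
`sectorWeightCirc (2n)` of `SectorPartitionOfUnityCircle` (width `sectorWidth (2n) = π4^{-n}`,
`sectorCount (2n) = 2·4ⁿ` sectors). We therefore introduce the two-index cutoff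
`sectorCutoffGen e₀ μ n m ω = f_{-n} · ζ_{m,ω}∘θ` (scale index `n`, angular index `m`;
`m = n` is the anisotropic cutoff, `m = 2n` the isotropic one) and PROVE for it, uniformly:

* `sectorCutoffGen_mem_Icc`, `sum_sectorCutoffGen` (`Σ_{ω<2^{m+1}} = f_{-n}`), the scale and angular
  supports, smoothness (`contDiff_sectorCutoffGen`, `0 < e₀ < 4 + μ`);
* the **sector box** `abs_normalCoord_le_of_gen_ne_zero`, `abs_tangentCoord_le_of_gen_ne_zero`:
  `|k'₁| ≤ C_r e₀ 4^{-n} + C_n (¾w_m)²`, `|k'₂| ≤ C_r e₀ 4^{-n} + C_t (¾ w_m)` in the frame at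
  `θ_{m,ω}` (BGM 2003 Lemma 7.3 with width `w_m`);
* the isotropic specialisation `isotropicCutoff e₀ μ n ω̄ = sectorCutoffGen e₀ μ n (2n) ω̄` with
  `sectorWidth_two_mul : w_{2n} = π 4^{-n}` and the box `|k'₁| ≤ isoNormalExtent n`,
  `|k'₂| ≤ isoTangentExtent n`, both `O(4^{-n}) = O(γ^h)` — (2.58).

Everything is PROVED; the definitions are `sectorCutoffGen`, `isotropicCutoff` and the two extents.

## Sources

* G. Benfatto, A. Giuliani, V. Mastropietro, Ann. Henri Poincaré 7 (2006) 809–898, §2.5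
  (2.57)–(2.58) (arXiv:cond-mat/0507686 p. 11). [BenfattoGiulianiMastropietro2006]
* G. Benfatto, A. Giuliani, V. Mastropietro, Ann. Henri Poincaré 4 (2003) 137–193, §7.1 Lemmas
  7.2–7.3. [BenfattoGiulianiMastropietro2003]
-/

noncomputable section

open Real Set Filter Complex
open scoped Topology

namespace Literature.MathematicalPhysics.QuantumLattice

/-! ### The two-index sector cutoff -/

/-- **The two-index sector cutoff** `f_{-n}(k) ζ_{m,ω}(θ(k⃗))` (scale index `n`, angular index `m`). [cite: BenfattoGiulianiMastropietro2006, §2.5 (2.46), (2.57)] -/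
def sectorCutoffGen (e₀ μ : ℝ) (n m : ℕ) (ω : ℤ) (p : ℝ × (Fin 2 → ℝ)) : ℝ :=
  scaleCutoffFn e₀ μ n p * sectorWeightCirc m ω (polarAngle p.2)

/-- **The isotropic cutoff** `F̄_{h,ω̄} = f_h ζ̄_{h,ω̄}` (`h = -n`, `γ = 4`): angular index `2n`. [cite: BenfattoGiulianiMastropietro2006, §2.5 (2.57)] -/
def isotropicCutoff (e₀ μ : ℝ) (n : ℕ) (ω : ℤ) (p : ℝ × (Fin 2 → ℝ)) : ℝ := sectorCutoffGen e₀ μ n (2 * n) ω p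

/-- The anisotropic cutoff is the case `m = n`. [folklore] -/
theorem anisotropicCutoff_eq_gen (e₀ μ : ℝ) (n : ℕ) (ω : ℤ) : anisotropicCutoff e₀ μ n ω = sectorCutoffGen e₀ μ n n ω := rfl

/-- The isotropic cutoff is the case `m = 2n`. [folklore] -/
theorem isotropicCutoff_eq_gen (e₀ μ : ℝ) (n : ℕ) (ω : ℤ) : isotropicCutoff e₀ μ n ω = sectorCutoffGen e₀ μ n (2 * n) ω := rfl

/-- `0 ≤ f ζ ≤ 1`. [folklore] -/
theorem sectorCutoffGen_mem_Icc {e₀ μ : ℝ} (he : 0 < e₀) (n m : ℕ) (ω : ℤ) (p : ℝ × (Fin 2 → ℝ)) :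
    sectorCutoffGen e₀ μ n m ω p ∈ Icc (0 : ℝ) 1 := by
  have h1 := scaleCutoffFn_mem_Icc he n p (μ := μ)
  have h2 := sectorWeightCirc_nonneg m ω (polarAngle p.2)
  have h3 := sectorWeightCirc_le_one m ω (polarAngle p.2)
  exact ⟨mul_nonneg h1.1 h2, mul_le_one₀ h1.2 h2 h3⟩

/-- **Sector decomposition**: `Σ_{ω<2^{m+1}} f_{-n} ζ_{m,ω} = f_{-n}`. [cite: BenfattoGiulianiMastropietro2006, §2.5 (2.45), (2.57)] -/
theorem sum_sectorCutoffGen (e₀ μ : ℝ) (n m : ℕ) (p : ℝ × (Fin 2 → ℝ)) :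
    ∑ ω ∈ Finset.range (sectorCount m), sectorCutoffGen e₀ μ n m ω p = scaleCutoffFn e₀ μ n p := by
  simp only [sectorCutoffGen, ← Finset.mul_sum, sum_sectorWeightCirc_eq_one, mul_one]

/-- Scale support. [cite: BenfattoGiulianiMastropietro2006, §2.3 (2.28)] -/
theorem sectorCutoffGen_ne_zero_scale {e₀ μ : ℝ} (he : 0 < e₀) {n m : ℕ} {ω : ℤ} {p : ℝ × (Fin 2 → ℝ)}
    (h : sectorCutoffGen e₀ μ n m ω p ≠ 0) :
    Real.sqrt (p.1 ^ 2 + (sqDispersion p.2 - μ) ^ 2) ∈ Ioo (e₀ * (4 : ℝ) ^ (-(n : ℤ) - 2)) (e₀ * (4 : ℝ) ^ (-(n : ℤ))) :=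
  scaleCutoffFn_ne_zero he (left_ne_zero_of_mul h)

/-- Angular support: `|θ(k⃗) - θ_{m,ω} - 2πj| < ¾ w_m` for some `j`. [cite: BenfattoGiulianiMastropietro2006, §2.5 (2.57)] -/
theorem sectorCutoffGen_ne_zero_angle {e₀ μ : ℝ} {n m : ℕ} {ω : ℤ} {p : ℝ × (Fin 2 → ℝ)}
    (h : sectorCutoffGen e₀ μ n m ω p ≠ 0) :
    ∃ j : ℤ, |polarAngle p.2 - ((ω : ℝ) + 1 / 2) * sectorWidth m - 2 * π * j| < 3 * sectorWidth m / 4 := by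
  by_contra hc
  push Not at hc
  exact (right_ne_zero_of_mul h) (sectorWeightCirc_eq_zero hc)

/-- **Smoothness** (for `0 < e₀ < 4 + μ`). [cite: BenfattoGiulianiMastropietro2006, §2.5 (2.57)] -/
theorem contDiff_sectorCutoffGen {e₀ μ : ℝ} (he : 0 < e₀) (heμ : e₀ < 4 + μ) (n m : ℕ) (ω : ℤ) {k : ℕ∞} :
    ContDiff ℝ k (sectorCutoffGen e₀ μ n m ω) := by
  refine contDiff_iff_contDiffAt.2 fun p => ?_
  by_cases hk : p.2 = 0
  · have hev : sectorCutoffGen e₀ μ n m ω =ᶠ[𝓝 p] fun _ => 0 := by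
      have h := scaleCutoffFn_eventuallyEq_zero he heμ n p.1
      rw [← hk] at h
      filter_upwards [h] with q hq
      rw [sectorCutoffGen, hq, zero_mul]
    exact (contDiffAt_const (c := (0 : ℝ))).congr_of_eventuallyEq hev
  · exact (contDiff_scaleCutoffFn he n).contDiffAt.mul
      ((contDiffAt_sectorWeightCirc_polarAngle m ω hk).comp p contDiff_snd.contDiffAt)

/-! ### The sector box in the frame at `θ_{m,ω}` -/

section Box

variable {μ : ℝ} (hμ₁ : -4 < μ) (hμ₂ : μ < -2 - Real.sqrt 2)
include hμ₁ hμ₂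

/-- **Normal extent**: `|k'₁| ≤ C_r e₀ 4^{-n} + C_n (¾ w_m)²`. [cite: BenfattoGiulianiMastropietro2003, §7.1 Lemma 7.3] -/
theorem abs_normalCoord_le_of_gen_ne_zero {e₀ : ℝ} (he : 0 < e₀) (he' : e₀ ≤ (4 + μ) / 2) {n m : ℕ} {ω : ℤ}
    {k₀ : ℝ} {k : Fin 2 → ℝ} (hk : ‖momToComplex k‖ ≤ π / 2) (h : sectorCutoffGen e₀ μ n m ω (k₀, k) ≠ 0) :
    |normalCoord μ (((ω : ℝ) + 1 / 2) * sectorWidth m) k| ≤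
      π / (4 * Real.sqrt ((4 + μ) / 2)) * (e₀ * (4 : ℝ) ^ (-(n : ℤ))) +
        2 * accelBound μ * Real.sqrt (π ^ 2 / 8 + (4 * π ^ 3 / (μ + 4)) ^ 2) / Real.sqrt (μ + 4) *
          (3 * sectorWidth m / 4) ^ 2 := by
  obtain ⟨j, hj⟩ := sectorCutoffGen_ne_zero_angle h
  have hf : scaleCutoffFn e₀ μ n (k₀, k) ≠ 0 := left_ne_zero_of_mul h
  have hrad := abs_norm_sub_fermiRadius_le hμ₁ hμ₂ he he' hk hf
  set θ₀ := ((ω : ℝ) + 1 / 2) * sectorWidth m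
  set θ' := polarAngle k - 2 * π * j with hθ'
  have hrepr : k = ‖momToComplex k‖ • dir θ' := by rw [hθ', dir_sub_two_pi_mul]; exact polar_repr k
  have hu : fermiRadius μ θ' = fermiRadius μ (polarAngle k) := fermiRadius_sub_two_pi_mul hμ₁ hμ₂ _ _
  have hgeo := abs_normalCoord_le hμ₁ hμ₂ θ₀ θ' ‖momToComplex k‖
  rw [← hrepr, hu] at hgeo
  have hang : |θ' - θ₀| ≤ 3 * sectorWidth m / 4 := by
    rw [hθ']; rw [show polarAngle k - 2 * π * j - θ₀ = polarAngle k - θ₀ - 2 * π * j by ring]; exact hj.le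
  have hsq : (θ' - θ₀) ^ 2 ≤ (3 * sectorWidth m / 4) ^ 2 := by
    rw [← sq_abs]; exact pow_le_pow_left₀ (abs_nonneg _) hang 2
  have hC : 0 ≤ 2 * accelBound μ * Real.sqrt (π ^ 2 / 8 + (4 * π ^ 3 / (μ + 4)) ^ 2) / Real.sqrt (μ + 4) := by
    have hA : 0 ≤ accelBound μ := (abs_nonneg _).trans (abs_fermiAX_le hμ₁ hμ₂ 0)
    positivity
  calc _ ≤ _ := hgeo
    _ ≤ _ := add_le_add hrad (mul_le_mul_of_nonneg_left hsq hC)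

/-- **Tangential extent**: `|k'₂| ≤ C_r e₀ 4^{-n} + 2√K (¾ w_m)`. [cite: BenfattoGiulianiMastropietro2003, §7.1 Lemma 7.3] -/
theorem abs_tangentCoord_le_of_gen_ne_zero {e₀ : ℝ} (he : 0 < e₀) (he' : e₀ ≤ (4 + μ) / 2) {n m : ℕ} {ω : ℤ}
    {k₀ : ℝ} {k : Fin 2 → ℝ} (hk : ‖momToComplex k‖ ≤ π / 2) (h : sectorCutoffGen e₀ μ n m ω (k₀, k) ≠ 0) :
    |tangentCoord μ (((ω : ℝ) + 1 / 2) * sectorWidth m) k| ≤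
      π / (4 * Real.sqrt ((4 + μ) / 2)) * (e₀ * (4 : ℝ) ^ (-(n : ℤ))) +
        2 * Real.sqrt (π ^ 2 / 8 + (4 * π ^ 3 / (μ + 4)) ^ 2) * (3 * sectorWidth m / 4) := by
  obtain ⟨j, hj⟩ := sectorCutoffGen_ne_zero_angle h
  have hf : scaleCutoffFn e₀ μ n (k₀, k) ≠ 0 := left_ne_zero_of_mul h
  have hrad := abs_norm_sub_fermiRadius_le hμ₁ hμ₂ he he' hk hf
  set θ₀ := ((ω : ℝ) + 1 / 2) * sectorWidth m
  set θ' := polarAngle k - 2 * π * j with hθ'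
  have hrepr : k = ‖momToComplex k‖ • dir θ' := by rw [hθ', dir_sub_two_pi_mul]; exact polar_repr k
  have hu : fermiRadius μ θ' = fermiRadius μ (polarAngle k) := fermiRadius_sub_two_pi_mul hμ₁ hμ₂ _ _
  have hgeo := abs_tangentCoord_le hμ₁ hμ₂ θ₀ θ' ‖momToComplex k‖
  rw [← hrepr, hu] at hgeo
  have hang : |θ' - θ₀| ≤ 3 * sectorWidth m / 4 := by
    rw [hθ']; rw [show polarAngle k - 2 * π * j - θ₀ = polarAngle k - θ₀ - 2 * π * j by ring]; exact hj.le
  calc _ ≤ _ := hgeo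
    _ ≤ _ := add_le_add hrad (mul_le_mul_of_nonneg_left hang (by positivity))

end Box

/-! ### The isotropic specialisation: everything is `O(γ^h)` -/

/-- `w_{2n} = π 4^{-n} = πγ^h`. [cite: BenfattoGiulianiMastropietro2006, §2.5 (2.57)] -/
theorem sectorWidth_two_mul (n : ℕ) : sectorWidth (2 * n) = π * (4 : ℝ) ^ (-(n : ℤ)) := by
  rw [sectorWidth, zpow_neg, zpow_natCast, pow_mul, show (2 : ℝ) ^ 2 = 4 by norm_num, div_eq_mul_inv]

/-- `|Ō_h| = 2·4ⁿ`. [cite: BenfattoGiulianiMastropietro2006, §2.5 (2.57)] -/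
theorem sectorCount_two_mul (n : ℕ) : sectorCount (2 * n) = 2 * 4 ^ n := by
  rw [sectorCount, pow_succ, pow_mul, show (2 : ℕ) ^ 2 = 4 by norm_num, mul_comm]

/-- The isotropic normal extent `B̄₁(n) = C_r e₀ 4^{-n} + C_n (¾π4^{-n})² = O(γ^h)`. [cite: BenfattoGiulianiMastropietro2006, §2.5 (2.58)] -/
def isoNormalExtent (μ e₀ : ℝ) (n : ℕ) : ℝ :=
  π / (4 * Real.sqrt ((4 + μ) / 2)) * (e₀ * (4 : ℝ) ^ (-(n : ℤ))) +
    2 * accelBound μ * Real.sqrt (π ^ 2 / 8 + (4 * π ^ 3 / (μ + 4)) ^ 2) / Real.sqrt (μ + 4) *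
      (3 * sectorWidth (2 * n) / 4) ^ 2

/-- The isotropic tangential extent `B̄₂(n) = C_r e₀ 4^{-n} + 2√K (¾π4^{-n}) = O(γ^h)`. [cite: BenfattoGiulianiMastropietro2006, §2.5 (2.58)] -/
def isoTangentExtent (μ e₀ : ℝ) (n : ℕ) : ℝ :=
  π / (4 * Real.sqrt ((4 + μ) / 2)) * (e₀ * (4 : ℝ) ^ (-(n : ℤ))) +
    2 * Real.sqrt (π ^ 2 / 8 + (4 * π ^ 3 / (μ + 4)) ^ 2) * (3 * sectorWidth (2 * n) / 4)

section Iso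

variable {μ : ℝ} (hμ₁ : -4 < μ) (hμ₂ : μ < -2 - Real.sqrt 2)
include hμ₁ hμ₂

omit hμ₁ hμ₂ in
/-- `0 ≤ F̄ ≤ 1`. [folklore] -/
theorem isotropicCutoff_mem_Icc {e₀ : ℝ} (he : 0 < e₀) (n : ℕ) (ω : ℤ) (p : ℝ × (Fin 2 → ℝ)) :
    isotropicCutoff e₀ μ n ω p ∈ Icc (0 : ℝ) 1 :=
  sectorCutoffGen_mem_Icc he n (2 * n) ω p

omit hμ₁ hμ₂ in
/-- **`Σ_{ω̄ ∈ Ō_h} F̄_{h,ω̄} = f_h`.** [cite: BenfattoGiulianiMastropietro2006, §2.5 (2.57)] -/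
theorem sum_isotropicCutoff (e₀ μ : ℝ) (n : ℕ) (p : ℝ × (Fin 2 → ℝ)) :
    ∑ ω ∈ Finset.range (sectorCount (2 * n)), isotropicCutoff e₀ μ n ω p = scaleCutoffFn e₀ μ n p :=
  sum_sectorCutoffGen e₀ μ n (2 * n) p

/-- `0 ≤ B̄₁`. [folklore] -/
theorem isoNormalExtent_nonneg {e₀ : ℝ} (he : 0 < e₀) (n : ℕ) : 0 ≤ isoNormalExtent μ e₀ n := by
  have hA : 0 ≤ accelBound μ := (abs_nonneg _).trans (abs_fermiAX_le hμ₁ hμ₂ 0)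
  have h4 : 0 < 4 + μ := by linarith
  have h4' : 0 < μ + 4 := by linarith
  unfold isoNormalExtent
  positivity

omit hμ₂ in
/-- `0 ≤ B̄₂`. [folklore] -/
theorem isoTangentExtent_nonneg {e₀ : ℝ} (he : 0 < e₀) (n : ℕ) : 0 ≤ isoTangentExtent μ e₀ n := by
  have h4 : 0 < 4 + μ := by linarith
  have hw := (sectorWidth_pos (2 * n)).le
  unfold isoTangentExtent
  positivity

/-- **The isotropic box, normal direction**: `|k'₁| ≤ B̄₁(n)` on the support of `F̄_{h,ω̄}` (`|k⃗| ≤ π/2`). [cite: BenfattoGiulianiMastropietro2006, §2.5 (2.58)] -/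
theorem abs_normalCoord_le_of_iso_ne_zero {e₀ : ℝ} (he : 0 < e₀) (he' : e₀ ≤ (4 + μ) / 2) {n : ℕ} {ω : ℤ}
    {k₀ : ℝ} {k : Fin 2 → ℝ} (hk : ‖momToComplex k‖ ≤ π / 2) (h : isotropicCutoff e₀ μ n ω (k₀, k) ≠ 0) :
    |normalCoord μ (((ω : ℝ) + 1 / 2) * sectorWidth (2 * n)) k| ≤ isoNormalExtent μ e₀ n :=
  abs_normalCoord_le_of_gen_ne_zero hμ₁ hμ₂ he he' hk h

/-- **The isotropic box, tangential direction**: `|k'₂| ≤ B̄₂(n)`. [cite: BenfattoGiulianiMastropietro2006, §2.5 (2.58)] -/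
theorem abs_tangentCoord_le_of_iso_ne_zero {e₀ : ℝ} (he : 0 < e₀) (he' : e₀ ≤ (4 + μ) / 2) {n : ℕ} {ω : ℤ}
    {k₀ : ℝ} {k : Fin 2 → ℝ} (hk : ‖momToComplex k‖ ≤ π / 2) (h : isotropicCutoff e₀ μ n ω (k₀, k) ≠ 0) :
    |tangentCoord μ (((ω : ℝ) + 1 / 2) * sectorWidth (2 * n)) k| ≤ isoTangentExtent μ e₀ n :=
  abs_tangentCoord_le_of_gen_ne_zero hμ₁ hμ₂ he he' hk h

omit hμ₁ hμ₂ in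
/-- **Both isotropic extents are `O(γ^h)`**: `B̄₁(n) ≤ C̄₁ 4^{-n}`, `B̄₂(n) = C̄₂ 4^{-n}`. [cite: BenfattoGiulianiMastropietro2006, §2.5 (2.58)] -/
theorem isoExtent_le {μ e₀ : ℝ} (hμ₁ : -4 < μ) (n : ℕ) :
    isoNormalExtent μ e₀ n ≤
        (π / (4 * Real.sqrt ((4 + μ) / 2)) * e₀ +
          2 * accelBound μ * Real.sqrt (π ^ 2 / 8 + (4 * π ^ 3 / (μ + 4)) ^ 2) / Real.sqrt (μ + 4) * (9 / 16 * π ^ 2)) *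
          (4 : ℝ) ^ (-(n : ℤ)) ∧
      isoTangentExtent μ e₀ n =
        (π / (4 * Real.sqrt ((4 + μ) / 2)) * e₀ + 2 * Real.sqrt (π ^ 2 / 8 + (4 * π ^ 3 / (μ + 4)) ^ 2) * (3 / 4 * π)) *
          (4 : ℝ) ^ (-(n : ℤ)) := by
  have hw := sectorWidth_two_mul n
  have h4pos : 0 < (4 : ℝ) ^ (-(n : ℤ)) := zpow_pos (by norm_num) _
  have h4le : (4 : ℝ) ^ (-(n : ℤ)) ≤ 1 := zpow_le_one_of_nonpos₀ (by norm_num) (by simp)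
  constructor
  · -- `(4^{-n})² ≤ 4^{-n}`
    have hsq : ((4 : ℝ) ^ (-(n : ℤ))) ^ 2 ≤ (4 : ℝ) ^ (-(n : ℤ)) := by
      rw [sq]; exact mul_le_of_le_one_left h4pos.le h4le
    have h4 : 0 < μ + 4 := by linarith
    have h4' : 0 < 4 + μ := by linarith
    have hA : 0 ≤ accelBound μ := by rw [accelBound_eq]; positivity
    have hCn : 0 ≤ 2 * accelBound μ * Real.sqrt (π ^ 2 / 8 + (4 * π ^ 3 / (μ + 4)) ^ 2) / Real.sqrt (μ + 4) := by
      positivity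
    have heq : isoNormalExtent μ e₀ n = π / (4 * Real.sqrt ((4 + μ) / 2)) * e₀ * (4 : ℝ) ^ (-(n : ℤ)) +
        2 * accelBound μ * Real.sqrt (π ^ 2 / 8 + (4 * π ^ 3 / (μ + 4)) ^ 2) / Real.sqrt (μ + 4) * (9 / 16 * π ^ 2) *
          ((4 : ℝ) ^ (-(n : ℤ))) ^ 2 := by
      rw [isoNormalExtent, hw]; ring
    rw [heq, add_mul]
    refine add_le_add le_rfl ?_
    have hK : 0 ≤ 2 * accelBound μ * Real.sqrt (π ^ 2 / 8 + (4 * π ^ 3 / (μ + 4)) ^ 2) / Real.sqrt (μ + 4) * (9 / 16 * π ^ 2) := by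
      positivity
    exact mul_le_mul_of_nonneg_left hsq hK
  · rw [isoTangentExtent, hw]; ring

end Iso

end Literature.MathematicalPhysics.QuantumLattice

end
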